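import Literature.Probability.Percolation.GladkovZiminKernelMeasure
import Summits.CriticalPhenomena.PercolationContinuityZ3.Theorems.PercNearOneGluingNoHeavyLowerTailCertRowsGroupData
import HarnessLib

/-!
# `NoHeavyLowerTail` (stmt-CriticalPhenomena-4575) — certificate rows V: Gladkov–Zimin kernel row groups

Support file (prover prim-ineq-prove-1, new-inequality factory; `--supports stmt-CriticalPhenomena-4575`): the adapter
turning a **Gladkov–Zimin kernel** on the 52 consistent connection patterns of the five terminals into a GROUP of product
rows for the reflective certificate checkers (`CertCheck.check`, `CertGeneral.checkQ`), valid IN SUM at every cell law.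

A kernel is a `52 × 52` integer array `K` indexed by pattern INDICES (positions in `CertCells.consPatterns`); it is
*valid* (`GZSpec.valid`, decidable) when `K(a,d) + K(b,c) ≤ K(a,c) + K(b,d)` for all strictly finer-than pairs `a < b`,
`c < d` of consistent patterns (bit inclusion `PatternSunflower.BitSub`).  For a valid kernel the tree's measure form of
Gladkov–Zimin's Theorem 2.3 (`Literature.Probability.Percolation.prodBernoulli_kernel_labelClass_le`, labelling a
configuration by its pattern number, which is monotone under opening edges) gives, at the cell law `x_c = μ(Cell v c)`,
`Σ_{a,b} K(a,b) x_a x_b ≤ Σ_a K(a,a) x_a` (`GZSpec.kernel_le`); `GZSpec.rows` encodes the two sides as checker rows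
(off-diagonal / diagonal entries by sign, the right-hand side homogenised with `μ[⊤] = 1`) and `GZSpec.rowSum` is the
summed validity the quadratic checker consumes.

Contents: `bitSub_trans`; the label preorder `GZLab` (pattern numbers, refinement order on the consistent patterns);
`patNum`/`gzLab` (+ `patNum_lt`, `mem_cell_patNum`, `cons_patNum`, `gzLab_mono`, `setOf_gzLab_eq`, `gzT`, `gzLab_mem`);
`kget`, `pidx`, `GZSpec` (+ `.A`, `.valid`, `.kernelCond`, `.kernel_le`, `.rows`, `.rowSum`, `.rowSum_all`).
No named facts, no sorries, standard axioms.
[cite: GladkovZimin2024HK, Thm. 2.3; Gladkov2024StrongFKG, Thm. 2.1]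
-/

noncomputable section

namespace Summit.CriticalPhenomena.PercolationContinuityZ3.Theorems

open MeasureTheory Set Literature.Probability.Percolation
open Literature.Probability.LatticeModels (prodBernoulli)
open scoped Classical BigOperators
open PatternCells CertCheck CertCells PatternSunflower

namespace CertCells

variable {n : ℕ}

/-! ## The refinement preorder on pattern numbers -/

/-- Bit inclusion is transitive. [folklore] -/
theorem bitSub_trans {a b c : ℕ} (hab : BitSub a b = true) (hbc : BitSub b c = true) : BitSub a c = true := by
  unfold BitSub at *
  simp only [List.all_eq_true, List.mem_range, Bool.or_eq_true, Bool.not_eq_true'] at *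
  intro p hp
  rcases hab p hp with h | h
  · exact Or.inl h
  · rcases hbc p hp with h' | h'
    · rw [h] at h'
      exact absurd h' (by decide)
    · exact Or.inr h'

/-- The label type of the Gladkov–Zimin labelling: pattern numbers. [folklore] -/
def GZLab : Type := ℕ

namespace GZLab

/-- Labels have decidable equality (they are natural numbers). [folklore] -/
instance : DecidableEq GZLab := inferInstanceAs (DecidableEq ℕ)

/-- A pattern number as a label. [folklore] -/
def ofNat (m : ℕ) : GZLab := m

/-- The underlying pattern number. [folklore] -/
def toNat (a : GZLab) : ℕ := a

/-- `toNat (ofNat m) = m`. [folklore] -/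
@[simp] theorem toNat_ofNat (m : ℕ) : toNat (ofNat m) = m := rfl

/-- The refinement preorder: equal, or two consistent patterns `< 1024` under bit inclusion. [folklore] -/
protected def le (a b : GZLab) : Prop :=
  a = b ∨ (a.toNat < 1024 ∧ b.toNat < 1024 ∧ Cons5 a.toNat = true ∧ Cons5 b.toNat = true ∧ BitSub a.toNat b.toNat = true)

/-- The refinement preorder on labels. [folklore] -/
instance : Preorder GZLab where
  le := GZLab.le
  le_refl a := Or.inl rfl
  le_trans a b c hab hbc := by
    rcases hab with rfl | ⟨ha, hb, hca, hcb, hab⟩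
    · exact hbc
    rcases hbc with rfl | ⟨_, hc, _, hcc, hbc⟩
    · exact Or.inr ⟨ha, hb, hca, hcb, hab⟩
    · exact Or.inr ⟨ha, hc, hca, hcc, bitSub_trans hab hbc⟩

/-- Unfolding `≤`. [folklore] -/
theorem le_iff (a b : GZLab) : a ≤ b ↔
    a = b ∨ (a.toNat < 1024 ∧ b.toNat < 1024 ∧ Cons5 a.toNat = true ∧ Cons5 b.toNat = true ∧
      BitSub a.toNat b.toNat = true) := Iff.rfl

end GZLab

/-! ## The pattern number of a configuration -/

/-- The pattern number of a configuration (the cell it lies in). [folklore] -/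
def patNum (v : Fin 5 → Fin n) (ω : BondConfig (Fin n)) : ℕ := Classical.choose (exists_mem_cell v ω)

/-- `patNum < 1024`. [folklore] -/
theorem patNum_lt (v : Fin 5 → Fin n) (ω : BondConfig (Fin n)) : patNum v ω < 1024 :=
  (Classical.choose_spec (exists_mem_cell v ω)).1

/-- A configuration lies in the cell of its pattern number. [folklore] -/
theorem mem_cell_patNum (v : Fin 5 → Fin n) (ω : BondConfig (Fin n)) : ω ∈ Cell v (patNum v ω) :=
  (Classical.choose_spec (exists_mem_cell v ω)).2

/-- The pattern number is consistent. [folklore] -/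
theorem cons_patNum (v : Fin 5 → Fin n) (ω : BondConfig (Fin n)) : Cons5 (patNum v ω) = true :=
  consistent_of_mem_cell v (mem_cell_patNum v ω)

/-- The Gladkov–Zimin label of a configuration. [folklore] -/
def gzLab (v : Fin 5 → Fin n) (ω : BondConfig (Fin n)) : GZLab := GZLab.ofNat (patNum v ω)

/-- **Opening edges coarsens the pattern**: the labelling is monotone. [folklore] -/
theorem gzLab_mono (v : Fin 5 → Fin n) : ∀ ⦃ω ω' : BondConfig (Fin n)⦄, ω ⊆ ω' → gzLab v ω ≤ gzLab v ω' := by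
  intro ω ω' hle
  exact Or.inr ⟨patNum_lt v ω, patNum_lt v ω', cons_patNum v ω, cons_patNum v ω',
    bitSub_of_subset v hle (mem_cell_patNum v ω) (mem_cell_patNum v ω')⟩

/-- The label class of a pattern number `< 1024` is its cell. [folklore] -/
theorem setOf_gzLab_eq (v : Fin 5 → Fin n) {a : ℕ} (ha : a < 1024) :
    {ω | gzLab v ω = GZLab.ofNat a} = Cell v a := by
  ext ω
  simp only [Set.mem_setOf_eq]
  constructor
  · intro h
    have h' : patNum v ω = a := h
    rw [← h']
    exact mem_cell_patNum v ω
  · intro h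
    show patNum v ω = a
    exact cell_unique v (patNum_lt v ω) ha (mem_cell_patNum v ω) h

/-- The finite set of labels: the consistent patterns. [folklore] -/
def gzT : Finset GZLab := ((consPatterns.map GZLab.ofNat : List GZLab)).toFinset

/-- Every label lies in `gzT`. [folklore] -/
theorem gzLab_mem (v : Fin 5 → Fin n) (ω : BondConfig (Fin n)) : gzLab v ω ∈ gzT := by
  unfold gzT gzLab
  rw [List.mem_toFinset, List.mem_map]
  exact ⟨_, mem_consPatterns (patNum_lt v ω) (cons_patNum v ω), rfl⟩

/-! ## Kernel validity and the kernel inequality -/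

/-- A valid kernel satisfies the Gladkov–Zimin condition for the label preorder. [folklore] -/
theorem GZSpec.kernelCond (s : GZSpec) (hs : s.valid = true) :
    ∀ ⦃a b c d : GZLab⦄, a ≤ b → c ≤ d →
      (s.A a.toNat d.toNat : ℝ) + s.A b.toNat c.toNat ≤ s.A a.toNat c.toNat + s.A b.toNat d.toNat := by
  intro a b c d hab hcd
  by_cases heq1 : a = b
  · subst heq1; linarith
  by_cases heq2 : c = d
  · subst heq2; linarith
  rcases hab with h | ⟨ha, hb, hca, hcb, hab⟩
  · exact absurd h heq1
  rcases hcd with h | ⟨hc, hd, hcc, hcd', hcd⟩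
  · exact absurd h heq2
  have hne1 : a.toNat ≠ b.toNat := fun h => heq1 h
  have hne2 : c.toNat ≠ d.toNat := fun h => heq2 h
  have hp := mem_strictPairs (mem_consPatterns ha hca) (mem_consPatterns hb hcb) hab hne1
  have hq := mem_strictPairs (mem_consPatterns hc hcc) (mem_consPatterns hd hcd') hcd hne2
  unfold GZSpec.valid at hs
  rw [List.all_eq_true] at hs
  have h1 := hs _ hp
  rw [List.all_eq_true] at h1
  have h2 := h1 _ hq
  simp only [decide_eq_true_eq] at h2
  exact_mod_cast h2

/-- A `Finset` sum over `gzT` is a list sum over `consPatterns`. [folklore] -/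
theorem sum_gzT (f : GZLab → ℝ) : ∑ a ∈ gzT, f a = (consPatterns.map fun m => f (GZLab.ofNat m)).sum := by
  have hnd : (consPatterns.map GZLab.ofNat).Nodup := nodup_consPatterns.map fun _ _ h => h
  unfold gzT
  rw [List.sum_toFinset _ hnd, List.map_map]
  rfl

/-- **The kernel inequality at the cell law** (Gladkov–Zimin, Thm. 2.3, on the pattern labelling):
`Σ_{a,b} K(a,b) x_a x_b ≤ Σ_a K(a,a) x_a` for a valid kernel, `x_c = μ(Cell v c)`. [cite: GladkovZimin2024HK, Thm. 2.3] -/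
theorem GZSpec.kernel_le (s : GZSpec) (hs : s.valid = true) (w : Sym2 (Fin n) → unitInterval) (v : Fin 5 → Fin n) :
    (consPatterns.map fun a => (consPatterns.map fun b =>
        (s.A a b : ℝ) * ((prodBernoulli w).real (Cell v a) * (prodBernoulli w).real (Cell v b))).sum).sum ≤
      (consPatterns.map fun a => (s.A a a : ℝ) * (prodBernoulli w).real (Cell v a)).sum := by
  have key := prodBernoulli_kernel_labelClass_le w (gzLab v) (gzLab_mono v) gzT (gzLab_mem v)
    (fun a b => (s.A a.toNat b.toNat : ℝ)) (s.kernelCond hs)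
  rw [sum_gzT] at key
  simp only [sum_gzT] at key
  have hcl : ∀ m ∈ consPatterns, (prodBernoulli w).real {ω | gzLab v ω = GZLab.ofNat m} = (prodBernoulli w).real (Cell v m) :=
    fun m hm => by rw [setOf_gzLab_eq v (lt_of_mem_consPatterns hm)]
  have e1 : (consPatterns.map fun m => (consPatterns.map fun m' =>
      (s.A (GZLab.ofNat m).toNat (GZLab.ofNat m').toNat : ℝ) *
        ((prodBernoulli w).real {ω | gzLab v ω = GZLab.ofNat m} *
          (prodBernoulli w).real {ω | gzLab v ω = GZLab.ofNat m'})).sum).sum =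
      (consPatterns.map fun a => (consPatterns.map fun b =>
        (s.A a b : ℝ) * ((prodBernoulli w).real (Cell v a) * (prodBernoulli w).real (Cell v b))).sum).sum := by
    refine congrArg List.sum (List.map_congr_left fun m hm => ?_)
    refine congrArg List.sum (List.map_congr_left fun m' hm' => ?_)
    rw [hcl m hm, hcl m' hm']
    rfl
  have e2 : (consPatterns.map fun m => (s.A (GZLab.ofNat m).toNat (GZLab.ofNat m).toNat : ℝ) *
      (prodBernoulli w).real {ω | gzLab v ω = GZLab.ofNat m}).sum =
      (consPatterns.map fun a => (s.A a a : ℝ) * (prodBernoulli w).real (Cell v a)).sum := by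
    refine congrArg List.sum (List.map_congr_left fun m hm => ?_)
    rw [hcl m hm]
    rfl
  rw [e1, e2] at key
  exact key

/-- **The rows of a valid kernel group hold IN SUM at every cell law.** [cite: GladkovZimin2024HK, Thm. 2.3] -/
theorem GZSpec.rowSum (s : GZSpec) (hs : s.valid = true) (w : Sym2 (Fin n) → unitInterval) (v : Fin 5 → Fin n) :
    let x : ℕ → ℝ := fun m => (prodBernoulli w).real (Cell v m)
    (s.rows.map fun r => (r.wt : ℝ) * evalM x r.mult * (linEval x r.e1 * linEval x r.e2)).sum ≤
      (s.rows.map fun r => (r.wt : ℝ) * evalM x r.mult * (linEval x r.e3 * linEval x r.e4)).sum := by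
  intro x
  have hx : ∀ i, 0 ≤ x i := fun _ => measureReal_nonneg
  have hL : linEval x (patCells fun _ => true) = 1 := linEval_patCells_true w v
  rw [← sub_nonneg]
  unfold GZSpec.rows
  rw [sum_map_flatMap_sub]
  have inner : ∀ a ∈ consPatterns,
      (((consPatterns.flatMap fun b => s.entryRows a b).map fun r => (r.wt : ℝ) * evalM x r.mult * (linEval x r.e3 * linEval x r.e4)).sum -
        ((consPatterns.flatMap fun b => s.entryRows a b).map fun r => (r.wt : ℝ) * evalM x r.mult * (linEval x r.e1 * linEval x r.e2)).sum) =
      (s.wt : ℝ) * evalM x s.mult * ((s.A a a : ℝ) * x a - (consPatterns.map fun b => (s.A a b : ℝ) * (x a * x b)).sum) := by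
    intro a ha
    rw [sum_map_flatMap_sub]
    simp only [GZSpec.entryRows_balance, hL, mul_one]
    rw [sum_map_const_mul', sum_map_sub', sum_diag_ite (fun b => (s.A a b : ℝ) * x a) ha]
  rw [List.map_congr_left inner, sum_map_const_mul']
  refine mul_nonneg (mul_nonneg (Nat.cast_nonneg _) (evalM_nonneg x hx _)) ?_
  rw [sum_map_sub', sub_nonneg]
  exact s.kernel_le hs w v

/-- Rows valid in sum over a list of kernel groups. [folklore] -/
theorem GZSpec.rowSum_all (specs : List GZSpec) (hvalid : specs.all GZSpec.valid = true) (w : Sym2 (Fin n) → unitInterval)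
    (v : Fin 5 → Fin n) :
    let x : ℕ → ℝ := fun m => (prodBernoulli w).real (Cell v m)
    ((specs.flatMap GZSpec.rows).map fun r => (r.wt : ℝ) * evalM x r.mult * (linEval x r.e1 * linEval x r.e2)).sum ≤
      ((specs.flatMap GZSpec.rows).map fun r => (r.wt : ℝ) * evalM x r.mult * (linEval x r.e3 * linEval x r.e4)).sum := by
  intro x
  induction specs with
  | nil => simp
  | cons s rest ih =>
    simp only [List.all_cons, Bool.and_eq_true] at hvalid
    rw [List.flatMap_cons, List.map_append, List.map_append, List.sum_append, List.sum_append]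
    exact add_le_add (GZSpec.rowSum s hvalid.1 w v) (ih hvalid.2)


/-- **The Gladkov–Zimin kernel groups are sound.** [cite: GladkovZimin2024HK, Thm. 2.3] -/
theorem gzSound : ∀ s : GZSpec, s.valid = true → GroupHolds s.rows := fun s hs _ w v => GZSpec.rowSum s hs w v

end CertCells

end Summit.CriticalPhenomena.PercolationContinuityZ3.Theorems

end
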